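import Summits.Langlands.Langlands.Theses.EisensteinDegreeShift

/-!
# Sketch — crux-ideate `stmt-Langlands-18372` (ideator k = 2, round 1)

First checkable statement of the line `eisenstein-floor-kw-web`:

  `BorelFLReciprocity` (X = item 18368, the route's target)
  + a CONDUCTOR-ONE BOREL VOID at (K, n, p)   (Fontaine/Tate/Serre/Şengün-type discriminant-bound void;
    at (ℚ(i), 2, 3) it is Fontaine's classification of finite flat 3-group schemes over ℤ[i],
    Invent. Math. 81 (1985); Khare, Durham survey (LMS LN 320) p. 344)
  ⟹ CONDUCTOR-ONE FONTAINE–LAFFAILLE RECIPROCITY (B) at (K, n, p) for EVERY residual type.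

At (ℚ(i), 2, 3) the conclusion is the FLOOR of the Khare–Wintenberger ladder over the Gaussian field
(summit card `kw-ladder-gaussian-field`): 3 is inert, so residually-Borel + crystalline HT {0,1} does NOT
force ordinarity and no Skinner–Wiles-type theorem applies — X is exactly the engine the floor needs.
Everything below elaborates sorry-free (`lean check` rc 0).
-/

namespace Summit.Langlands.Langlands.Cruxes.SectorComplement.EisensteinFloor

open Summit.Langlands.Langlands.Theses.EisensteinDegreeShift
open IsDedekindDomain NumberField

/-- The Fontaine–Laffaille clause of `BorelFLReciprocity`, verbatim, as a predicate on `ρ`: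
crystalline at every `v ∣ p` for Fontaine's pinned datum, `n` distinct `τ`-labelled Hodge–Tate weights
in an interval of length `≤ p - 2`. -/
def FLClause (K : Type) [Field K] [NumberField K] (n p : ℕ) [Fact p.Prime]
    (ρ : Literature.NumberTheory.GaloisRepresentations.FramedGaloisRep K (PadicAlgCl p) n) : Prop :=
  ∀ (v : HeightOneSpectrum (𝓞 K)) (hv : ((p : ℕ) : 𝓞 K) ∈ v.asIdeal),
    let D := Literature.NumberTheory.PAdicHodge.fontainePstAdicCompletion v p hv;
    D.IsCrystallineFramed (ρ.toLocal v) ∧ (letI := D.algebra; ∀ τ : v.adicCompletion K →ₐ[ℚ_[p]] PadicAlgCl p,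
      let M := ρ.labelledHodgeTateWeightsAt v D.algebra D.𝔅 τ.toRingHom;
      M.Nodup ∧ Multiset.card M = n ∧ ∀ a ∈ M, ∀ b ∈ M, a - b ≤ (p : ℤ) - 2)

/-- CONDUCTOR-ONE BOREL VOID at `(K, n, p)`: every irreducible `ρ : Γ_K → GL_n(ℚ̄_p)` that is
unramified at every place not above `p` and Fontaine–Laffaille above `p` admits a residually
upper-triangular integral model.  For `(ℚ(i), 2, 3)` this is (a consequence of) Fontaine's theorem that
finite flat `3`-group schemes over `ℤ[i]` are extensions of rank-one objects; in general it is a finite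
Odlyzko-bound computation (Fontaine's different bound `rd < rd_K · p^{1+1/(p-1)}`). -/
def ConductorOneBorelVoid (K : Type) [Field K] [NumberField K] (n p : ℕ) [Fact p.Prime] : Prop :=
  ∀ (O : ValuationSubring (PadicAlgCl p)), O = (Valued.v : Valuation (PadicAlgCl p) NNReal).valuationSubring →
  ∀ (ρ : Literature.NumberTheory.GaloisRepresentations.FramedGaloisRep K (PadicAlgCl p) n),
    ρ.toGaloisRep.IsIrreducible →
    (∀ v : HeightOneSpectrum (𝓞 K), ((p : ℕ) : 𝓞 K) ∉ v.asIdeal → ρ.IsUnramifiedAt v) →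
    FLClause K n p ρ →
    ∃ ρ₀ : Field.absoluteGaloisGroup K →* GL (Fin n) O, ρ.HasUpperTriangularIntegralModel ρ₀

/-- CONDUCTOR-ONE FONTAINE–LAFFAILLE RECIPROCITY (B) at `(K, n, p)`, ALL residual types: every
irreducible `ρ : Γ_K → GL_n(ℚ̄_p)` unramified away from `p` and FL above `p` is Satake–Frobenius
compatible a.e. with an L-algebraic cuspidal `π` of `GL_n(𝔸_K)`.  At `(ℚ(i), 2, 3)`: level-one
weight-two 3-adic reciprocity over the Gaussian field = the floor of the KW ladder. -/
def ConductorOneFLReciprocity (K : Type) [Field K] [NumberField K] (n p : ℕ) [Fact p.Prime] : Prop :=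
  ∀ (hcpt : Literature.NumberTheory.Automorphic.isCompact_glFiniteIntegralLevel n K) (ι : PadicAlgCl p ≃+* ℂ)
    (ρ : Literature.NumberTheory.GaloisRepresentations.FramedGaloisRep K (PadicAlgCl p) n),
    ρ.toGaloisRep.IsIrreducible →
    (∀ v : HeightOneSpectrum (𝓞 K), ((p : ℕ) : 𝓞 K) ∉ v.asIdeal → ρ.IsUnramifiedAt v) →
    FLClause K n p ρ →
    ∃ π : Literature.NumberTheory.Automorphic.CuspidalAutomorphicRepData n K hcpt,
      π.1.IsLAlgebraic ∧ ∀ᶠ v : HeightOneSpectrum (𝓞 K) in Filter.cofinite,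
        Summit.Langlands.SatakeFrobCompatibleAt ι π.1 ρ v

/-- Conductor one ⇒ unramified almost everywhere (only the finitely many `v ∣ p` can ramify). -/
theorem ae_unramified_of_conductorOne (K : Type) [Field K] [NumberField K] (n p : ℕ) [Fact p.Prime]
    (ρ : Literature.NumberTheory.GaloisRepresentations.FramedGaloisRep K (PadicAlgCl p) n)
    (hunr : ∀ v : HeightOneSpectrum (𝓞 K), ((p : ℕ) : 𝓞 K) ∉ v.asIdeal → ρ.IsUnramifiedAt v) :
    ∀ᶠ v : HeightOneSpectrum (𝓞 K) in Filter.cofinite, ρ.IsUnramifiedAt v := by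
  have hp0 : (Ideal.span {((p : ℕ) : 𝓞 K)} : Ideal (𝓞 K)) ≠ 0 := by
    rw [Ne, Ideal.zero_eq_bot, Ideal.span_singleton_eq_bot]
    exact_mod_cast (Fact.out : p.Prime).ne_zero
  refine Filter.eventually_cofinite.2 ((Ideal.finite_factors hp0).subset ?_)
  intro v hv
  have hmem : ((p : ℕ) : 𝓞 K) ∈ v.asIdeal := by
    by_contra h
    exact hv (hunr v h)
  exact Ideal.dvd_span_singleton.2 hmem

/-- **THE EISENSTEIN FLOOR LEMMA** (first lemma of the line, proved): the route's target `X =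
BorelFLReciprocity` plus a conductor-one Borel void at `(K, n, p)` (K CM, `2 ≤ n < p`, `p` unramified
in `K`) gives conductor-one Fontaine–Laffaille reciprocity at `(K, n, p)` for every residual type. -/
theorem conductorOneFL_of_borelFL_of_void (hX : BorelFLReciprocity)
    (K : Type) [Field K] [NumberField K] (hK : IsCMField K) (n : ℕ) (hn : 2 ≤ n)
    (p : ℕ) [Fact p.Prime] (hp : n < p)
    (hur : ∀ v : HeightOneSpectrum (𝓞 K), ((p : ℕ) : 𝓞 K) ∈ v.asIdeal →
      ¬ v.asIdeal ^ 2 ∣ Ideal.span {((p : ℕ) : 𝓞 K)})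
    (hV : ConductorOneBorelVoid K n p) : ConductorOneFLReciprocity K n p := by
  intro hcpt ι ρ hirr hunr hFL
  obtain ⟨ρ₀, hut⟩ := hV _ rfl ρ hirr hunr hFL
  exact hX K hK n hn p hp hur _ rfl hcpt ι ρ ρ₀ hirr (ae_unramified_of_conductorOne K n p ρ hunr) hut
    (fun v hv => hFL v hv)

/-- The floor as ONE Prop (what a line card / triage can point at): X enlarged by every certified void. -/
def EisensteinFloor : Prop :=
  ∀ (K : Type) [Field K] [NumberField K], IsCMField K → ∀ (n : ℕ), 2 ≤ n → ∀ (p : ℕ) [Fact p.Prime], n < p →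
    (∀ v : HeightOneSpectrum (𝓞 K), ((p : ℕ) : 𝓞 K) ∈ v.asIdeal → ¬ v.asIdeal ^ 2 ∣ Ideal.span {((p : ℕ) : 𝓞 K)}) →
    ConductorOneBorelVoid K n p → ConductorOneFLReciprocity K n p

theorem eisensteinFloor_of_borelFL (hX : BorelFLReciprocity) : EisensteinFloor :=
  fun K _ _ hK n hn p _ hp hur hV => conductorOneFL_of_borelFL_of_void hX K hK n hn p hp hur hV

end Summit.Langlands.Langlands.Cruxes.SectorComplement.EisensteinFloor
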